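import Literature.AnabelianGeometry.EtaleTheta.ThetaRigidityToy
import Mathlib.GroupTheory.SpecificGroups.Cyclic
import HarnessLib

/-!
# A level-`3` degenerate model of the [EtTh] §2 interface `RigidData`, and the schema witness for
# Cor. 2.18 (iv) (fibres)

Companion of `ThetaRigidityToy.lean` / `ThetaRigiditySchemaWitness.lean` (cell `abc-iut`).  The
FACT row F-0624 `RigidData.Cor218_iv_fibre` ([EtTh] Cor. 2.18 (iv), PRIMS p.61: "the automorphisms of
the model mono-theta environment inducing the identity on `Π^tp_Y` are, up to `μ_N`-conjugacy, the
twists by `Hom(Π^tp_Y/Π^tp_Ÿ, μ_N)`") HOLDS at the level-`1` toy (there `μ_1 = 1` and the envelope is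
`Π^tp_Y` itself), so its schema status needs a toy with a nontrivial cyclotome.  Here:

* `RigidData.ToyN3.toy : RigidData 3 1` — `Π^tp_X := ℤ × (ℤ/2 × ℤ/3)` discrete abelian, `G_K := 1`,
  `μ_3 := ℤ/3` with TRIVIAL Galois action, `Π^tp_Y := 0 × (ℤ/2 × ℤ/3)`, `Π^tp_Ÿ := (l·Δ_Θ) := 0 × 0 × ℤ/3`,
  `Ker(Π ↠ Π^Θ) := 1`, `thetaMod :=` the `ℤ/3`-coordinate, the single theta cocycle `η₀ := thetaMod`
  (forced by the axiom `cocycle_lDeltaTheta`), no cusps.  EVERY interface axiom holds.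
* `flipEnv` — the automorphism `(u, y) ↦ (u⁻¹ · δ(y), y)` of the envelope `μ_3 × Π^tp_Y` with
  `δ :=` the `ℤ/3`-coordinate of `Π^tp_Y`; it induces the IDENTITY on `Π^tp_Y`, fixes `Im s^Θ_Ÿ` pointwise
  and preserves `D_Y = 1`, so it is an automorphism of the model mono-theta environment; but on the
  cyclotome it is INVERSION, whereas every `μ_3`-conjugate of a twist `x ↦ φ(x̄)·x` is the identity on
  `μ_3`.  Hence `not_forall_cor218_iv_fibre` (F-0624 is a SCHEMA: consumable at a named instance only).

Honest framing: a toy of a lawless interface; nothing here is a statement about [EtTh] (refereed) or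
about the genuine model of lane C2 (`Discharge/Sec2Cor218ivAllLevels`, `Sec2LiftingProofs`, …).  Written
by the cell `abc-iut` (seat abc-iut-w5-d175; F-TRANCHES 147 of D-0078 (S1)).  No side taken on
[IUTchIII] Cor. 3.12; typed ≠ proved.  No instances, no notation.

Reference: [MochizukiEtTh2009] S. Mochizuki, *The étale theta function …*, Publ. RIMS 45 (2009):
Def. 2.13 pp.47–48, Cor. 2.18 (iv) pp.61–63 (PRIMS text pages).
-/

namespace Literature.AnabelianGeometry.EtaleTheta

namespace RigidData

namespace ToyN3

open RigidData.Toy (M2 g g_ne_one)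

/-! ## §1. The level-`3` toy -/

/-- `ℤ/3` written multiplicatively (the cyclotome `μ_3` AND the `(l·Δ_Θ)`-coordinate).
[cite: MochizukiEtTh2009, Def 2.13 p.47] -/
abbrev M3 : Type := Multiplicative (ZMod 3)

/-- `K₃ := ℤ/2 × ℤ/3`. [cite: MochizukiEtTh2009, Def 2.13 p.47] -/
abbrev K3 : Type := M2 × M3

/-- The toy `Π^tp_X := ℤ × (ℤ/2 × ℤ/3)` (discrete, abelian). [cite: MochizukiEtTh2009, Def 2.13 p.47] -/
abbrev P3 : Type := Multiplicative ℤ × K3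

/-- The `ℤ/2`-coordinate. [cite: MochizukiEtTh2009, Def 2.13 p.47] -/
def q2 : P3 →* M2 := (MonoidHom.fst M2 M3).comp (MonoidHom.snd (Multiplicative ℤ) K3)

/-- The `ℤ/3`-coordinate. [cite: MochizukiEtTh2009, Def 2.13 p.47] -/
def q3 : P3 →* M3 := (MonoidHom.snd M2 M3).comp (MonoidHom.snd (Multiplicative ℤ) K3)

/-- `q2` on a tuple. [cite: MochizukiEtTh2009, Def 2.13 p.47] -/
@[simp] theorem q2_apply (z : Multiplicative ℤ) (a : M2) (t : M3) : q2 (z, (a, t)) = a := rfl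

/-- `q3` on a tuple. [cite: MochizukiEtTh2009, Def 2.13 p.47] -/
@[simp] theorem q3_apply (z : Multiplicative ℤ) (a : M2) (t : M3) : q3 (z, (a, t)) = t := rfl

/-- `Π^tp_Y := Ker(Π ↠ ℤ)`. [cite: MochizukiEtTh2009, Def 2.13 p.47] -/
abbrev PiY : Subgroup P3 := (MonoidHom.fst (Multiplicative ℤ) K3).ker

/-- `Π^tp_Ÿ := {ℤ/2-coordinate trivial} ∩ Π^tp_Y` (also `(l·Δ_Θ)`). [cite: MochizukiEtTh2009, Def 2.13 p.47] -/
abbrev PiYdd : Subgroup P3 := q2.ker ⊓ PiY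

/-- Membership in `Π^tp_Y`. [cite: MochizukiEtTh2009, Def 2.13 p.47] -/
theorem mem_PiY_iff (z : Multiplicative ℤ) (k : K3) : ((z, k) : P3) ∈ PiY ↔ z = 1 := by
  simp [Subgroup.mem_prod, Subgroup.mem_bot]

/-- Membership in `Π^tp_Ÿ`. [cite: MochizukiEtTh2009, Def 2.13 p.47] -/
theorem mem_PiYdd_iff (z : Multiplicative ℤ) (a : M2) (t : M3) :
    ((z, (a, t)) : P3) ∈ PiYdd ↔ a = 1 ∧ z = 1 := by
  simp [Subgroup.mem_inf, MonoidHom.mem_ker, Subgroup.mem_prod, Subgroup.mem_bot]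

/-- `[Π^tp_Y : Π^tp_Ÿ] = 2` at the toy. [cite: MochizukiEtTh2009, Def 2.13 p.47] -/
theorem index_PiYdd : (PiYdd.subgroupOf PiY).index = 2 := by
  change PiYdd.relIndex PiY = 2
  rw [Subgroup.inf_relIndex_right, Subgroup.relIndex_ker]
  have hmap : PiY.map q2 = ⊤ := by
    refine top_le_iff.mp fun a _ => ?_
    exact ⟨(1, (a, 1)), by simp [Subgroup.mem_prod], rfl⟩
  rw [hmap, Subgroup.card_top, Nat.card_eq_fintype_card]
  rfl

/-- `(l·Δ_Θ) ↠ μ_3`: the `ℤ/3`-coordinate. [cite: MochizukiEtTh2009, Def 2.13 p.46] -/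
def thetaMod : PiYdd →* M3 := q3.comp PiYdd.subtype

/-- The only theta cocycle of the toy: `η₀ := thetaMod` (forced by `cocycle_lDeltaTheta`).
[cite: MochizukiEtTh2009, Def 2.13 p.46] -/
def eta0 : PiYdd → M3 := fun x => thetaMod x

/-- Cubes are trivial in `ℤ/3`. [cite: MochizukiEtTh2009, Def 2.13 p.46] -/
theorem pow_three_eq_one (t : M3) : t ^ 3 = 1 := by
  revert t
  decide

/-- **The level-`3` toy `RigidData`** (with `l = 1`): `Π^tp_X = ℤ × (ℤ/2 × ℤ/3)` discrete abelian,
`G_K = 1`, `μ_3 = ℤ/3` with trivial action, `Π^tp_Ÿ = (l·Δ_Θ) = 0 × 0 × ℤ/3`, `Ker(Π ↠ Π^Θ) = 1`,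
`thetaMod =` the `ℤ/3`-coordinate, theta cocycles `{η₀}`, no cusps.  Every axiom of the interface is
satisfied. [cite: MochizukiEtTh2009, Cor 2.18 p.59] -/
@[reducible] noncomputable def toy : RigidData.{0} 3 1 where
  PiX := P3
  G := PUnit
  aug := 1
  aug_surjective := fun _ => ⟨1, Subsingleton.elim _ _⟩
  PiY := PiY
  PiY_normal := inferInstance
  PiY_open := isOpen_discrete _
  galYX := QuotientGroup.quotientKerEquivOfSurjective (MonoidHom.fst (Multiplicative ℤ) K3)
    (fun z => ⟨(z, 1), rfl⟩)
  PiYdd := PiYdd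
  PiYdd_le := inf_le_right
  PiYdd_normal := inferInstance
  PiYdd_open := isOpen_discrete _
  index_PiYdd := index_PiYdd
  mu := M3
  mu_cyclic := inferInstance
  card_mu := rfl
  chi := 1
  chi_ker_open := isOpen_discrete _
  thetaCocycles := {eta0}
  thetaCocycles_nonempty := Set.singleton_nonempty _
  isCocycle := by
    rintro η hη
    rw [Set.mem_singleton_iff] at hη
    subst hη
    exact fun x y => map_mul thetaMod x y
  locallyConstant := fun η _ => IsLocallyConstant.of_discrete η
  mul_coboundary_mem := by
    rintro η hη c
    rw [Set.mem_singleton_iff] at hη ⊢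
    subst hη
    funext x
    simp [CycEnvelope.coboundary]
  thetaKer := ⊥
  thetaKer_normal := inferInstance
  thetaKer_le := bot_le
  lDeltaTheta := PiYdd
  thetaKer_le_lDeltaTheta := bot_le
  lDeltaTheta_le := by
    rw [MonoidHom.ker_one]
    exact le_inf le_rfl le_top
  lDeltaTheta_normal := inferInstance
  thetaMod := thetaMod
  thetaMod_surjective := fun t => ⟨⟨(1, (1, t)), (mem_PiYdd_iff _ _ _).mpr ⟨rfl, rfl⟩⟩, rfl⟩
  thetaMod_ker := by
    rintro ⟨⟨z, a, t⟩, hx⟩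
    have hx' := (mem_PiYdd_iff z a t).mp hx
    constructor
    · intro h1
      have ht : t = 1 := h1
      refine ⟨1, Subgroup.one_mem _, 1, ?_⟩
      change ((z, (a, t)) : P3) = 1 * (1 : P3) ^ ((3 : ℕ+) : ℕ)
      rw [one_mul, one_pow, hx'.2, hx'.1, ht]
      rfl
    · rintro ⟨k, hk, ⟨⟨z', a', t'⟩, hh⟩, hkh⟩
      rw [Subgroup.mem_bot] at hk
      subst hk
      have h3 : ((((z', (a', t')) : P3)) ^ ((3 : ℕ+) : ℕ)).2.2 = 1 := pow_three_eq_one t'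
      change ((z, (a, t)) : P3) = 1 * ((z', (a', t')) : P3) ^ ((3 : ℕ+) : ℕ) at hkh
      change q3 (z, (a, t)) = 1
      rw [hkh, one_mul]
      exact h3
  thetaMod_conj := fun x y => congrArg thetaMod (Subtype.ext (by
    change x * (y : P3) * x⁻¹ = y
    rw [mul_comm x, mul_inv_cancel_right]))
  cocycle_thetaKer := by
    rintro η hη y hy
    rw [Set.mem_singleton_iff] at hη
    subst hη
    have : y = 1 := Subtype.ext ((Subgroup.mem_bot).mp hy)
    subst this
    exact map_one thetaMod
  cocycle_lDeltaTheta := by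
    rintro η hη y hy
    rw [Set.mem_singleton_iff] at hη
    subst hη
    rfl
  cuspY := fun _ => ∅
  cuspX := fun _ => ∅
  cuspX_neg := fun _ => rfl
  augYdd_surjective := fun _ => ⟨1, Subsingleton.elim _ _⟩
  thetaSections_conj := by
    intro η η' hη hη'
    have h1 : η = eta0 := hη
    have h2 : η' = eta0 := hη'
    subst h1 h2
    exact ThetaEnvData.IsKLConjugate.base

/-- `η₀` is a theta cocycle of the toy. [cite: MochizukiEtTh2009, Def 2.13 p.47] -/
theorem eta0_mem : eta0 ∈ toy.thetaCocycles := rfl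

/-! ## §2. The envelope of the toy is abelian; `D_Y = 1` -/

/-- The envelope `μ_3 ⋊ Π^tp_Y` of the toy (trivial action, abelian `Π^tp_Y`) is commutative.
[cite: MochizukiEtTh2009, Def 2.10 p.44] -/
theorem env_mul_comm (x y : toy.env) : x * y = y * x := by
  refine SemidirectProduct.ext ?_ ?_
  · change x.left * y.left = y.left * x.left
    exact mul_comm _ _
  · change x.right * y.right = y.right * x.right
    exact mul_comm _ _

/-- Inner automorphisms of the envelope are trivial. [cite: MochizukiEtTh2009, Def 2.13(i) p.47] -/
theorem conj_env_eq_one (z : toy.env) : MulAut.conj z = 1 := by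
  refine MulEquiv.ext fun x => ?_
  rw [MulAut.conj_apply, env_mul_comm z x, mul_inv_cancel_right]
  rfl

/-- `μ_3`-conjugacy classes of subgroups of the envelope are singletons.
[cite: MochizukiEtTh2009, Def 2.10 p.44] -/
theorem muConjClass_eq_singleton (H : Subgroup toy.env) :
    CycEnvelope.muConjClass toy.augY toy.chi H = {H} := by
  have hid : ∀ a : toy.mu,
      H.map (MulAut.conj (CycEnvelope.inMu toy.augY toy.chi a)).toMonoidHom = H := by
    intro a
    rw [conj_env_eq_one]
    exact Subgroup.map_id H
  ext K
  simp only [CycEnvelope.muConjClass, Set.mem_setOf_eq, Set.mem_singleton_iff, hid, exists_const]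

/-- Conjugation by the (abelian) toy `Π^tp_X` acts trivially on the envelope.
[cite: MochizukiEtTh2009, Def 2.13(i) p.47] -/
theorem conjX_eq_one (x : toy.PiX) : toy.toThetaEnvData.conjX x = 1 := by
  refine MulEquiv.ext fun y => SemidirectProduct.ext rfl (Subtype.ext ?_)
  change x * (y.right : P3) * x⁻¹ = (y.right : P3)
  rw [mul_comm x, mul_inv_cancel_right]

/-- A cocycle INFLATED from `G_K = 1` is trivial, so its shift is the identity.
[cite: MochizukiEtTh2009, Def 2.13(i) p.47] -/
theorem shift_inflated_eq_one {δ : toy.G → toy.mu}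
    (hδ : CycEnvelope.IsEnvCocycle toy.augY toy.chi (δ ∘ toy.augY)) :
    CycEnvelope.shift hδ = 1 := by
  have h1 : δ PUnit.unit = 1 := by
    have := hδ 1 1
    change δ PUnit.unit = δ PUnit.unit * δ PUnit.unit at this
    exact (mul_eq_left.mp this.symm)
  refine MulEquiv.ext fun x => SemidirectProduct.ext ?_ rfl
  change x.left * δ _ = x.left
  rw [show toy.augY x.right = PUnit.unit from rfl, h1, mul_one]

/-- `D_Y = 1` at the level-`3` toy. [cite: MochizukiEtTh2009, Def 2.13(i) p.47] -/
theorem DY_eq_bot : toy.DY = ⊥ := by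
  refine (Subgroup.closure_eq_bot_iff).mpr ?_
  rintro x (⟨δ, hδ, hc, rfl⟩ | ⟨y, hc, rfl⟩)
  · rw [Set.mem_singleton_iff]
    have h1 : (⟨CycEnvelope.shift hδ, hc⟩ : contMulAut toy.env) = 1 :=
      Subtype.ext (shift_inflated_eq_one hδ)
    rw [h1, map_one]
  · rw [Set.mem_singleton_iff]
    have h1 : (⟨toy.toThetaEnvData.conjX y, hc⟩ : contMulAut toy.env) = 1 :=
      Subtype.ext (conjX_eq_one y)
    rw [h1, map_one]

/-- The envelope of the toy is discrete (a theorem, not an instance).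
[cite: MochizukiEtTh2009, Def 2.13(ii) p.47] -/
theorem discreteTopology_env : DiscreteTopology toy.env :=
  DiscreteTopology.of_continuous_injective
    (f := fun x : toy.env => (x.left, x.right)) continuous_induced_dom
    (fun x y h => by
      obtain ⟨h1, h2⟩ := Prod.mk.inj h
      exact SemidirectProduct.ext h1 h2)

/-! ## §3. The flip automorphism and the schema witness for Cor. 2.18 (iv) -/

/-- `δ : Π^tp_Y → μ_3`, the `ℤ/3`-coordinate: a homomorphism extending `η₀` to `Π^tp_Y`.
[cite: MochizukiEtTh2009, Cor 2.18(iv) p.63] -/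
noncomputable def delta : toy.PiY →* M3 := q3.comp PiY.subtype

/-- In `ℤ/3`, `t · t = t⁻¹`. [cite: MochizukiEtTh2009, Def 2.13 p.46] -/
theorem mul_self_eq_inv (t : M3) : t * t = t⁻¹ := by
  rw [← pow_two, eq_inv_iff_mul_eq_one, ← pow_succ]
  exact pow_three_eq_one t

/-- **The flip** `(u, y) ↦ (u⁻¹ · δ(y), y)` of the envelope `μ_3 × Π^tp_Y`: an automorphism (the
envelope is abelian) inducing the identity on `Π^tp_Y` and inversion on `μ_3`.
[cite: MochizukiEtTh2009, Cor 2.18(iv) p.61] -/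
noncomputable def flipEnv : toy.env ≃ₜ* toy.env :=
  { toFun := fun x => ⟨x.left⁻¹ * delta x.right, x.right⟩
    invFun := fun x => ⟨x.left⁻¹ * delta x.right, x.right⟩
    left_inv := fun x => by
      refine SemidirectProduct.ext ?_ rfl
      change (x.left⁻¹ * delta x.right)⁻¹ * delta x.right = x.left
      rw [mul_inv_rev, inv_inv, mul_comm (delta x.right)⁻¹, mul_assoc, inv_mul_cancel, mul_one]
    right_inv := fun x => by
      refine SemidirectProduct.ext ?_ rfl
      change (x.left⁻¹ * delta x.right)⁻¹ * delta x.right = x.left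
      rw [mul_inv_rev, inv_inv, mul_comm (delta x.right)⁻¹, mul_assoc, inv_mul_cancel, mul_one]
    map_mul' := fun x y => by
      refine SemidirectProduct.ext ?_ rfl
      change (x.left * y.left)⁻¹ * delta (x.right * y.right) =
        x.left⁻¹ * delta x.right * (y.left⁻¹ * delta y.right)
      rw [map_mul, mul_inv_rev]
      simp only [mul_assoc, mul_comm, mul_left_comm]
    continuous_toFun := by haveI := discreteTopology_env; exact continuous_of_discreteTopology
    continuous_invFun := by haveI := discreteTopology_env; exact continuous_of_discreteTopology }

/-- `flipEnv` induces the identity on `Π^tp_Y`. [cite: MochizukiEtTh2009, Cor 2.18(iv) p.61] -/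
theorem proj_flipEnv (x : toy.env) :
    CycEnvelope.proj toy.augY toy.chi (flipEnv x) = CycEnvelope.proj toy.augY toy.chi x := rfl

/-- `flipEnv` fixes the theta section pointwise: `(η₀(y)⁻¹)⁻¹ · δ(y) = η₀(y)² = η₀(y)⁻¹`.
[cite: MochizukiEtTh2009, Def 2.13(i) p.47] -/
theorem flipEnv_sTheta (y : toy.PiYdd) :
    flipEnv (toy.toThetaEnvData.sTheta eta0_mem y) = toy.toThetaEnvData.sTheta eta0_mem y := by
  refine SemidirectProduct.ext ?_ rfl
  change (eta0 y)⁻¹⁻¹ * delta (toy.toThetaEnvData.inclYdd y) = (eta0 y)⁻¹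
  rw [inv_inv]
  exact mul_self_eq_inv _

/-- **`flipEnv` is an automorphism of the model mono-theta environment** of the level-`3` toy.
[cite: MochizukiEtTh2009, Def 2.13(ii) p.48] -/
theorem exists_isoFlip : ∃ α : (toy.modelMono eta0_mem).Iso (toy.modelMono eta0_mem), α.e = flipEnv := by
  refine ⟨{ e := flipEnv, map_D := ?_, map_sTheta := ?_ }, rfl⟩
  · change toy.DY.map _ = toy.DY
    rw [DY_eq_bot, Subgroup.map_bot]
  · change (fun H => H.map flipEnv.toMulEquiv.toMonoidHom) ''
        CycEnvelope.muConjClass _ _ (toy.toThetaEnvData.sTheta eta0_mem).range =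
      CycEnvelope.muConjClass _ _ (toy.toThetaEnvData.sTheta eta0_mem).range
    rw [muConjClass_eq_singleton, Set.image_singleton, Set.singleton_eq_singleton_iff]
    ext x
    constructor
    · rintro ⟨_, ⟨y, rfl⟩, rfl⟩
      exact ⟨y, (flipEnv_sTheta y).symm⟩
    · rintro ⟨y, rfl⟩
      exact ⟨_, ⟨y, rfl⟩, flipEnv_sTheta y⟩

/-- The generator of `μ_3`. [cite: MochizukiEtTh2009, Def 2.13 p.46] -/
abbrev zeta : M3 := Multiplicative.ofAdd 1

/-- `ζ⁻¹ ≠ ζ` in `μ_3`. [cite: MochizukiEtTh2009, Def 2.13 p.46] -/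
theorem zeta_inv_ne : zeta⁻¹ ≠ zeta := by decide

/-- **F-0624 `Cor218_iv_fibre` is a schema**: at the level-`3` toy, `flipEnv` is an automorphism of
the model mono-theta environment inducing the identity on `Π^tp_Y`, but it is NOT a `μ_3`-conjugate of
a twist `x ↦ φ(x̄)·x` (all of which are the identity on the cyclotome, while `flipEnv` inverts it).
[cite: MochizukiEtTh2009, Cor 2.18(iv) p.61] -/
theorem not_forall_cor218_iv_fibre : ¬ ∀ (N : ℕ+) (l : ℕ) (R : RigidData.{0} N l), R.Cor218_iv_fibre := by
  intro h
  obtain ⟨α, hα⟩ := exists_isoFlip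
  obtain ⟨φ, -, c, hx⟩ := (h 3 1 toy eta0 eta0_mem).1 α (fun x => by rw [hα]; rfl)
  have h1 := hx (CycEnvelope.inMu toy.augY toy.chi zeta)
  rw [hα, conj_env_eq_one, MulAut.one_apply] at h1
  have h2 : CycEnvelope.proj toy.augY toy.chi (CycEnvelope.inMu toy.augY toy.chi zeta) = 1 := by
    simp
  rw [h2, map_one, map_one, one_mul] at h1
  have h3 := congrArg SemidirectProduct.left h1
  change zeta⁻¹ * delta 1 = zeta at h3
  rw [map_one, mul_one] at h3
  exact zeta_inv_ne h3

end ToyN3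

end RigidData

end Literature.AnabelianGeometry.EtaleTheta
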